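import Literature.AlgebraicGeometry.Frobenioids.PadicFrobenioidMonoidData
import Literature.AlgebraicGeometry.Frobenioids.PadicFrobenioidSplittingMonoid
import Literature.AlgebraicGeometry.Frobenioids.PadicFrobenioidRationalData
import Literature.AlgebraicGeometry.Frobenioids.RealificationRoots
import HarnessLib

/-!
# Frobenioids II, Theorem 2.4 (i), proof p. 20: «fieldwise saturated» — preliminaries on the divisor line
# `Φ₀(A)^gp ⊇ ord(K_A^×) = ℤ · ord(π_A)` of a `p`-adic Frobenioid (PROOFS)

Mochizuki, *The geometry of Frobenioids II*, Kyushu J. Math. **62** (2008) 401–460, §1 Example 1.1 (ii) p. 408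
("`ord(K^×) ⊆ Φ(K) (⊆ ord(K^×) ⊗_ℤ ℝ)` … fieldwise saturated") and §2, proof of Theorem 2.4 (i), p. 417
ll. 9–22 ("the (easily verified) fact that `Φᵢ` is fieldwise saturated if and only if (a) … divisible (b) …
`O^⊳(C) ⥲ O^⊳(B)^{Gal(B/C)}`") [cite: MochizukiFrdII2008, Thm 2.4 (i) p.20].

PROOF-ONLY file (abc-iut cell, seat abc-iut-w5-d229; SUBDAG-FrdII-Thm24 row L01 `FsCharacterization`, part 1;
no definitions). For a datum `d : PadicFrd.Datum D p` (abc-iut-L1-t4) and an object `A` over the `p`-adic local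
field `K_A`, everything happens on the line `Φ₀(A)^gp = (ord(O_{K_A}^⊳) ⊗ ℝ_{≥0})^gp`, which contains the lattice
`ord(K_A^×) = ℤ · ord(π_A)` (`Datum.ordUnitsSubgroup`) and the group `Φ(A)^gp` (the closure of the range of
`Datum.phiGp`); `d.IsFieldwiseSaturated` says the former lies in the latter. We record:
* `exists_uniformizer` — a uniformizer `π_A ∈ O_{K_A}^⊳`: every class of `ord(O_{K_A}^⊳)` is a power of `[π_A]`
  (abc-iut-L1-d10's `isZMonoprime_ordInt`), so `ord(K_A^×) ≤ H ↔ ord(π_A) ∈ H` (`ordUnitsSubgroup_le_iff`);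
* injectivity / torsion-freeness / sharpness bookkeeping on `Φ₀(A)^gp` (`ordIntGp_injective`, `phiGp_injective`,
  `gp_eq_of_pow_eq`, `eq_one_of_phiGp_mul_ordIntGp_eq_one`);
* the shape of `Φ(A)^gp`: every element is `[c]` or `[c]⁻¹` with `c ∈ Φ(A)` (`Φ(A)` monoprime, divisibility total;
  `exists_eq_phiGp_or_eq_inv`), whence **fieldwise saturated at `A` ⇒ `ord(π_A) = [c₀]` for an EFFECTIVE
  `c₀ ∈ Φ(A)`** (`exists_phiGp_eq_generator`) and **some positive multiple of `ord(π_A)` is effective in `Φ(A)`**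
  unconditionally (`exists_pow_generator_eq_phiGp`, from "`B(A) → Φ^gp(A)` is nonzero");
* the naturality of `ord`, `ι`, `Div₀`, `Div_B` along an arrow `f : B → C` of `D`, over the concrete monoids
  (`phiZeroGp_ordIntGp`, `phiZeroGp_phiGp`, `phiZeroGp_divZeroHom`, `divB_mapB`, `alg_baseMap_over`).
The criterion itself is `PadicFieldwiseSaturatedCriterion.lean`. Classical bookkeeping; nothing here bears on
[IUTchIII] Cor. 3.12; no statement of the paper is strengthened.
-/

noncomputable section

namespace Literature.AlgebraicGeometry.Frobenioids

open CategoryTheory Opposite Function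

universe v u

namespace PadicFrd

namespace Datum

variable {D : Type u} [Category.{v} D] {p : ℕ} [Fact p.Prime] (d : Datum D p)

/-! ### The divisor monoid `ord(O_{K_A}^⊳)` of the local field under `A` -/

/-- `ord(O_{K_A}^⊳)` is `ℤ`-monoprime for every object `A` (`K_A` is a `p`-adic local field, `Datum.isPadicLocal`;
abc-iut-L1-d10's `isZMonoprime_ordInt`). [cite: MochizukiFrdII2008, Ex 1.1 (i) p.7] -/
theorem isZMonoprime_ordInt_fld (A : D) : IsZMonoprime (OrdInt (d.fld A)) := by
  obtain ⟨inst, hfin, hc⟩ := (d.isPadicLocal A).exists_finite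
  letI := inst
  haveI := hfin
  exact PadicFld.isZMonoprime_ordInt (d.base.obj A) hc

/-- `ord(O_{K_A}^⊳)` is monoprime. [cite: MochizukiFrdII2008, Ex 1.1 (i) p.7] -/
theorem isMonoprime_ordInt_fld (A : D) : IsMonoprime (OrdInt (d.fld A)) :=
  IsMonoprime.ofZ (d.isZMonoprime_ordInt_fld A)

/-- **A uniformizer of `K_A`**: an element `π ∈ O_{K_A}^⊳` whose class `[π] ≠ 1` generates `ord(O_{K_A}^⊳) ≅ ℤ_{≥0}`
("`ord(V) := V/O_K^× (≅ ℤ)`", FrdII p. 8). [cite: MochizukiFrdII2008, Ex 1.1 (i) p.7] -/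
theorem exists_uniformizer (A : D) :
    ∃ π : intNonzero (d.fld A), Associates.mk π ≠ 1 ∧
      ∀ a : OrdInt (d.fld A), ∃ k : ℕ, a = Associates.mk π ^ k := by
  obtain ⟨⟨e⟩⟩ := d.isZMonoprime_ordInt_fld A
  obtain ⟨π, hπ⟩ := Associates.mk_surjective (e.symm (Multiplicative.ofAdd 1))
  have h1 : e (Associates.mk π) = Multiplicative.ofAdd 1 := by rw [hπ, MulEquiv.apply_symm_apply]
  refine ⟨π, ?_, fun a => ⟨Multiplicative.toAdd (e a), ?_⟩⟩
  · intro h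
    rw [h, map_one, ← ofAdd_zero] at h1
    exact zero_ne_one (Multiplicative.ofAdd.injective h1)
  · rw [hπ, ← map_pow]
    apply e.injective
    rw [MulEquiv.apply_symm_apply, ← ofAdd_nsmul, smul_eq_mul, mul_one, ofAdd_toAdd]

/-! ### The line `Φ₀(A)^gp`: injectivity, torsion-freeness, sharpness -/

/-- `ord(O_{K_A}^⊳) → Φ₀(A)^gp`, `a ↦ a ⊗ 1`, is injective (monoprime into its realification, then into the
groupification of a cancellative monoid). [cite: MochizukiFrdII2008, Ex 1.1 (i) p.7] -/
theorem ordIntGp_injective (A : D) : Injective (d.ordIntGp A) := by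
  haveI := isCancelMul_realification (OrdInt (d.fld A))
  exact (Algebra.GrothendieckGroup.of_injective (M := Realification (OrdInt (d.fld A)))).comp
    (Realification.of_injective (d.isMonoprime_ordInt_fld A))

/-- `Φ(A) → Φ₀(A)^gp`, `c ↦ [ι c]`, is injective. [cite: MochizukiFrdII2008, Ex 1.1 (ii) p.8] -/
theorem phiGp_injective (A : D) : Injective (d.phiGp A) := by
  haveI := isCancelMul_realification (OrdInt (d.fld A))
  exact (Algebra.GrothendieckGroup.of_injective (M := Realification (OrdInt (d.fld A)))).comp
    (d.ι_injective (op A))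

/-- `phiGp` is the groupification `ι^gp` of `ι_A` on the image of `Φ(A)`: `[ι c] = ι^gp [c]`.
[cite: MochizukiFrdII2008, Ex 1.1 (ii) p.8] -/
theorem phiGp_eq_monGp_map_of (A : D) (c : d.Φ.obj (op A)) :
    d.phiGp A c = MonGp.map (d.ιHom A) (Algebra.GrothendieckGroup.of c) := by
  rw [MonGp.map_of]
  rfl

/-- `ι^gp : Φ(A)^gp → Φ₀(A)^gp` is injective. [cite: MochizukiFrdII2008, Ex 1.1 (ii) p.8] -/
theorem monGp_map_ιHom_injective (A : D) : Injective (MonGp.map (d.ιHom A)) := by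
  haveI := isCancelMul_realification (OrdInt (d.fld A))
  exact MonGp.map_injective _ (d.ιHom_injective A)

/-- `Φ₀(A)^gp` is torsion-free: `x ^ n = y ^ n`, `n ≥ 1` ⇒ `x = y` (the `n`-th power maps of `M ⊗ ℝ_{≥0}` are
injective). [cite: MochizukiFrdI2008, §0 p.11] -/
theorem gp_eq_of_pow_eq (A : D) {x y : Algebra.GrothendieckGroup (Realification (OrdInt (d.fld A)))} {n : ℕ}
    (hn : 0 < n) (h : x ^ n = y ^ n) : x = y := by
  haveI := isCancelMul_realification (OrdInt (d.fld A))
  -- write `x / y = [a] / [b]`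
  obtain ⟨a, b, hab⟩ := grothendieckGroup_exists_mul_of_eq_of (x / y)
  have h1 : (x / y) ^ n = 1 := by rw [div_pow, h, div_self']
  have h2 : Algebra.GrothendieckGroup.of (b ^ n) = Algebra.GrothendieckGroup.of (a ^ n) := by
    rw [map_pow, map_pow, ← hab, mul_pow, h1, one_mul]
  have h3 : b = a := Realification.pow_injective hn (Algebra.GrothendieckGroup.of_injective h2)
  rw [h3, mul_eq_right] at hab
  exact div_eq_one.mp hab

/-- Sharpness on the line: if `[ι c] · (a ⊗ 1) = 1` in `Φ₀(A)^gp` for `c ∈ Φ(A)` and `a ∈ ord(O_{K_A}^⊳)` (two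
EFFECTIVE elements), then `c = 1` and `a = 1` (`M ⊗ ℝ_{≥0}` is sharp). [cite: MochizukiFrdI2008, §0 p.11] -/
theorem eq_one_of_phiGp_mul_ordIntGp_eq_one (A : D) (c : d.Φ.obj (op A)) (a : OrdInt (d.fld A))
    (h : d.phiGp A c * d.ordIntGp A a = 1) : c = 1 ∧ a = 1 := by
  haveI := isCancelMul_realification (OrdInt (d.fld A))
  have h1 : d.ιHom A c * Realification.of (OrdInt (d.fld A)) a = 1 := by
    apply Algebra.GrothendieckGroup.of_injective (M := Realification (OrdInt (d.fld A)))
    rw [map_mul, map_one]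
    exact h
  have hc : d.ιHom A c = 1 :=
    (isSharp_realification _).eq_one_of_isUnit _ (IsUnit.of_mul_eq_one _ h1)
  have ha : Realification.of (OrdInt (d.fld A)) a = 1 := by rwa [hc, one_mul] at h1
  exact ⟨d.ιHom_injective A (by rw [hc, map_one]),
    Realification.of_injective (d.isMonoprime_ordInt_fld A) (by rw [ha, map_one])⟩

/-- Variant: `[ι c] · [ι c'] = 1` for `c, c' ∈ Φ(A)` forces `c = 1`. [cite: MochizukiFrdI2008, §0 p.11] -/
theorem eq_one_of_phiGp_mul_phiGp_eq_one (A : D) (c c' : d.Φ.obj (op A))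
    (h : d.phiGp A c * d.phiGp A c' = 1) : c = 1 := by
  have h1 : d.phiGp A (c * c') = 1 := by rw [map_mul, h]
  have h2 : c * c' = 1 := d.phiGp_injective A (by rw [h1, map_one])
  exact (d.isMonoprime (op A)).isSharp.eq_one_of_isUnit _ (IsUnit.of_mul_eq_one _ h2)

/-! ### The lattice `ord(K_A^×)` and the group `Φ(A)^gp` on the line -/

/-- `(a ⊗ 1) = Div₀(a)` for `a ∈ O_{K_A}^⊳` regarded in `K_A^×`. [cite: MochizukiFrdII2008, Ex 1.1 (i) p.7] -/
theorem ordIntGp_mk_eq_divZeroHom (A : D) (π : intNonzero (d.fld A)) :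
    d.ordIntGp A (Associates.mk π) = divZeroHom (d.fld A) (intNonzeroToUnits (d.fld A) π) := by
  rw [divZeroHom_intNonzeroToUnits]
  rfl

/-- With a uniformizer `π`: `ord(K_A^×) ≤ H ↔ ord(π) ∈ H` for every subgroup `H` of `Φ₀(A)^gp`.
[cite: MochizukiFrdII2008, Ex 1.1 (ii) p.8] -/
theorem ordUnitsSubgroup_le_iff (A : D) {π : intNonzero (d.fld A)}
    (hπ : ∀ a : OrdInt (d.fld A), ∃ k : ℕ, a = Associates.mk π ^ k)
    (H : Subgroup (Algebra.GrothendieckGroup (Realification (OrdInt (d.fld A))))) :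
    d.ordUnitsSubgroup A ≤ H ↔ d.ordIntGp A (Associates.mk π) ∈ H := by
  constructor
  · intro h
    exact h (Subgroup.subset_closure ⟨Associates.mk π, rfl⟩)
  · intro h
    rw [ordUnitsSubgroup, Subgroup.closure_le]
    rintro _ ⟨a, rfl⟩
    obtain ⟨k, rfl⟩ := hπ a
    rw [map_pow]
    exact H.pow_mem h k

/-- `ord(a) ∈ ord(K_A^×)` for `a ∈ ord(O_{K_A}^⊳)`. [cite: MochizukiFrdII2008, Ex 1.1 (ii) p.8] -/
theorem ordIntGp_mem_ordUnitsSubgroup (A : D) (a : OrdInt (d.fld A)) : d.ordIntGp A a ∈ d.ordUnitsSubgroup A :=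
  Subgroup.subset_closure ⟨a, rfl⟩

/-- `Div₀(x) ∈ ord(K_A^×)` for every `x ∈ K_A^×` (`Div₀ = (· ⊗ 1)^gp ∘ div`).
[cite: MochizukiFrdII2008, Ex 1.1 (ii) p.8] -/
theorem divZeroHom_mem_ordUnitsSubgroup (A : D) (x : (d.fld A)ˣ) :
    divZeroHom (d.fld A) x ∈ d.ordUnitsSubgroup A := by
  rw [divZeroHom, MonoidHom.comp_apply]
  obtain ⟨a, b, hab⟩ := grothendieckGroup_exists_mul_of_eq_of (divUnits (d.fld A) x)
  have h : divUnits (d.fld A) x = Algebra.GrothendieckGroup.of a / Algebra.GrothendieckGroup.of b :=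
    eq_div_iff_mul_eq'.mpr hab
  rw [h, map_div, MonGp.map_of, MonGp.map_of]
  exact Subgroup.div_mem _ (d.ordIntGp_mem_ordUnitsSubgroup A a) (d.ordIntGp_mem_ordUnitsSubgroup A b)

/-- Every element of `ord(K_A^×) = ℤ · ord(π)` is an INTEGER power of `ord(π)`. [cite: MochizukiFrdII2008, Ex 1.1 (ii) p.8] -/
theorem exists_zpow_eq_of_mem_ordUnitsSubgroup (A : D) {π : intNonzero (d.fld A)}
    (hπ : ∀ a : OrdInt (d.fld A), ∃ k : ℕ, a = Associates.mk π ^ k)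
    {x : Algebra.GrothendieckGroup (Realification (OrdInt (d.fld A)))} (hx : x ∈ d.ordUnitsSubgroup A) :
    ∃ k : ℤ, x = d.ordIntGp A (Associates.mk π) ^ k := by
  have hle : d.ordUnitsSubgroup A ≤ Subgroup.zpowers (d.ordIntGp A (Associates.mk π)) :=
    (d.ordUnitsSubgroup_le_iff A hπ _).mpr (Subgroup.mem_zpowers _)
  obtain ⟨k, hk⟩ := Subgroup.mem_zpowers_iff.mp (hle hx)
  exact ⟨k, hk.symm⟩

/-- `[ι c] ∈ Φ(A)^gp`. [cite: MochizukiFrdII2008, Ex 1.1 (ii) p.8] -/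
theorem phiGp_mem_closure (A : D) (c : d.Φ.obj (op A)) :
    d.phiGp A c ∈ Subgroup.closure (Set.range (d.phiGp A)) :=
  Subgroup.subset_closure ⟨c, rfl⟩

/-- `ι^gp γ ∈ Φ(A)^gp` for every `γ ∈ Φ(A)^gp` (abstract groupification). [cite: MochizukiFrdII2008, Ex 1.1 (ii) p.8] -/
theorem monGp_map_ιHom_mem_closure (A : D) (γ : Algebra.GrothendieckGroup (d.Φ.obj (op A))) :
    MonGp.map (d.ιHom A) γ ∈ Subgroup.closure (Set.range (d.phiGp A)) := by
  obtain ⟨a, b, hab⟩ := grothendieckGroup_exists_mul_of_eq_of γ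
  have h : γ = Algebra.GrothendieckGroup.of a / Algebra.GrothendieckGroup.of b := eq_div_iff_mul_eq'.mpr hab
  rw [h, map_div, ← phiGp_eq_monGp_map_of, ← phiGp_eq_monGp_map_of]
  exact Subgroup.div_mem _ (d.phiGp_mem_closure A a) (d.phiGp_mem_closure A b)

/-- **The shape of `Φ(A)^gp`**: every element is `[ι c]` or `[ι c]⁻¹` for some `c ∈ Φ(A)` — divisibility in the
monoprime monoid `Φ(A)` is total (`IsMonoprime.dvd_or_dvd`). [cite: MochizukiFrdII2008, Ex 1.1 (ii) p.8] -/
theorem exists_eq_phiGp_or_eq_inv (A : D) {δ : Algebra.GrothendieckGroup (Realification (OrdInt (d.fld A)))}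
    (hδ : δ ∈ Subgroup.closure (Set.range (d.phiGp A))) :
    ∃ c : d.Φ.obj (op A), δ = d.phiGp A c ∨ δ = (d.phiGp A c)⁻¹ := by
  have hle : Subgroup.closure (Set.range (d.phiGp A)) ≤ (MonGp.map (d.ιHom A)).range := by
    rw [Subgroup.closure_le]
    rintro _ ⟨c, rfl⟩
    exact ⟨Algebra.GrothendieckGroup.of c, (d.phiGp_eq_monGp_map_of A c).symm⟩
  obtain ⟨γ, rfl⟩ := hle hδ
  obtain ⟨a, b, hab⟩ := grothendieckGroup_exists_mul_of_eq_of γ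
  have h : γ = Algebra.GrothendieckGroup.of a / Algebra.GrothendieckGroup.of b := eq_div_iff_mul_eq'.mpr hab
  rcases (d.isMonoprime (op A)).dvd_or_dvd a b with ⟨c, hc⟩ | ⟨c, hc⟩
  · -- `b = a c`: `γ = [c]⁻¹`
    refine ⟨c, Or.inr ?_⟩
    rw [h, hc, map_div, map_mul, map_mul, ← phiGp_eq_monGp_map_of, ← phiGp_eq_monGp_map_of, div_mul_eq_div_div,
      div_self', one_div]
  · -- `a = b c`: `γ = [c]`
    refine ⟨c, Or.inl ?_⟩
    rw [h, hc, map_div, map_mul, map_mul, ← phiGp_eq_monGp_map_of, ← phiGp_eq_monGp_map_of, mul_comm, mul_div_assoc,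
      div_self', mul_one]

/-- **Fieldwise saturated at `A` ⇒ `ord(π_A)` is an EFFECTIVE class of `Φ(A)`**: `ord(π) = [ι c₀]` for some
`c₀ ∈ Φ(A)` (the alternative `ord(π) = [ι c]⁻¹` is excluded by sharpness). [cite: MochizukiFrdII2008, Thm 2.4 (i) p.20] -/
theorem exists_phiGp_eq_generator (hfs : d.IsFieldwiseSaturated) (A : D) {π : intNonzero (d.fld A)}
    (hπ1 : Associates.mk π ≠ 1) : ∃ c₀ : d.Φ.obj (op A), d.phiGp A c₀ = d.ordIntGp A (Associates.mk π) := by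
  have hmem : d.ordIntGp A (Associates.mk π) ∈ Subgroup.closure (Set.range (d.phiGp A)) :=
    hfs A (d.ordIntGp_mem_ordUnitsSubgroup A _)
  obtain ⟨c, hc | hc⟩ := d.exists_eq_phiGp_or_eq_inv A hmem
  · exact ⟨c, hc.symm⟩
  · exfalso
    have h1 : d.phiGp A c * d.ordIntGp A (Associates.mk π) = 1 := by rw [hc, mul_inv_cancel]
    exact hπ1 (d.eq_one_of_phiGp_mul_ordIntGp_eq_one A c _ h1).2

/-- The converse bookkeeping: `ord(K_A^×) ⊆ Φ(A)^gp` at `A` as soon as `ord(π) = [ι c₀]` for a uniformizer `π`.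
[cite: MochizukiFrdII2008, Thm 2.4 (i) p.20] -/
theorem ordUnitsSubgroup_le_of_phiGp_eq (A : D) {π : intNonzero (d.fld A)}
    (hπ : ∀ a : OrdInt (d.fld A), ∃ k : ℕ, a = Associates.mk π ^ k) {c₀ : d.Φ.obj (op A)}
    (h : d.phiGp A c₀ = d.ordIntGp A (Associates.mk π)) :
    d.ordUnitsSubgroup A ≤ Subgroup.closure (Set.range (d.phiGp A)) :=
  (d.ordUnitsSubgroup_le_iff A hπ _).mpr (h ▸ d.phiGp_mem_closure A c₀)

/-- **Unconditionally, some positive multiple of `ord(π_A)` is an effective class of `Φ(A)`**: `ord(π)^m = [ι c]`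
with `m ≥ 1`, `c ∈ Φ(A)` — from "`B(A) → Φ^gp(A)` is nonzero" (abc-iut-L6-t10's `exists_divB_eq_of`: some
`b ∈ B(A)` has `Div_B(b) = [c]`, `c ≠ 1`), the cartesian square (`Div₀(b|_{K^×}) = ι^gp Div_B(b)`), and
sharpness (a non-positive exponent would make `[ι c]` anti-effective). [cite: MochizukiFrdII2008, Thm 2.4 (i) p.20] -/
theorem exists_pow_generator_eq_phiGp (A : D) {π : intNonzero (d.fld A)}
    (hπ : ∀ a : OrdInt (d.fld A), ∃ k : ℕ, a = Associates.mk π ^ k) :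
    ∃ (m : ℕ) (c : d.Φ.obj (op A)), 0 < m ∧ d.ordIntGp A (Associates.mk π) ^ m = d.phiGp A c := by
  obtain ⟨b, c, hc1, hbc⟩ := d.exists_divB_eq_of (op A)
  -- `[ι c] = Div₀(b|_{K^×}) ∈ ord(K_A^×) = ℤ · ord(π)`
  have hsq : d.phiGp A c = divZeroHom (d.fld A) (d.resK A b) := by
    rw [d.divZeroHom_resK A b, hbc, phiGp_eq_monGp_map_of]
  obtain ⟨k, hk⟩ := d.exists_zpow_eq_of_mem_ordUnitsSubgroup A hπ
    (hsq ▸ d.divZeroHom_mem_ordUnitsSubgroup A (d.resK A b))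
  -- the exponent is positive
  rcases lt_or_ge 0 k with hk0 | hk0
  · refine ⟨k.toNat, c, by omega, ?_⟩
    rw [hk, ← zpow_natCast, Int.toNat_of_nonneg hk0.le]
  · exfalso
    have h1 : d.phiGp A c * d.ordIntGp A (Associates.mk π ^ (-k).toNat) = 1 := by
      rw [map_pow, hk, ← zpow_natCast, Int.toNat_of_nonneg (by omega), ← zpow_add, add_neg_cancel, zpow_zero]
    exact hc1 (d.eq_one_of_phiGp_mul_ordIntGp_eq_one A c _ h1).1

/-! ### Naturality along an arrow `f : B → C` of `D`, over the concrete monoids -/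

section Naturality

variable {B C : D} (f : B ⟶ C)

/-- `Φ₀^gp(f)(a ⊗ 1) = (ord(f) a) ⊗ 1`: the pull-back of `Φ₀^gp` on integral classes is the map of divisor
monoids induced by the (valuative) field homomorphism `K_C → K_B`. [cite: MochizukiFrdII2008, Ex 1.1 (i) p.7] -/
theorem phiZeroGp_ordIntGp (a : OrdInt (d.fld C)) :
    MonGp.map ((phiZeroOn d.base).map f.op).hom (d.ordIntGp C a) =
      d.ordIntGp B (ordIntMapOfHom (d.base.map f).alg (d.base.map f).isValHom a) := by
  change MonGp.map (Realification.map (ordIntMapOfHom (d.base.map f).alg (d.base.map f).isValHom))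
      (Algebra.GrothendieckGroup.of (Realification.of _ a)) = Algebra.GrothendieckGroup.of (Realification.of _ _)
  rw [MonGp.map_of, Realification.map_of]

/-- `Φ₀^gp(f)` is multiplicative on powers (stated over the concrete line, where `rw [map_pow]` does not find the
`CommMonCat`-carrier instance). [cite: MochizukiFrdII2008, Ex 1.1 (i) p.7] -/
theorem phiZeroGp_map_pow (x : Algebra.GrothendieckGroup (Realification (OrdInt (d.fld C)))) (n : ℕ) :
    MonGp.map ((phiZeroOn d.base).map f.op).hom (x ^ n) = MonGp.map ((phiZeroOn d.base).map f.op).hom x ^ n :=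
  map_pow _ x n

/-- `Φ₀^gp(f)` is multiplicative on integer powers. [cite: MochizukiFrdII2008, Ex 1.1 (i) p.7] -/
theorem phiZeroGp_map_zpow (x : Algebra.GrothendieckGroup (Realification (OrdInt (d.fld C)))) (n : ℤ) :
    MonGp.map ((phiZeroOn d.base).map f.op).hom (x ^ n) = MonGp.map ((phiZeroOn d.base).map f.op).hom x ^ n :=
  map_zpow _ x n

/-- `Φ₀^gp(f)[ι c] = [ι (Φ(f) c)]` (`ι : Φ ↪ Φ₀|_D` is natural). [cite: MochizukiFrdII2008, Ex 1.1 (ii) p.8] -/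
theorem phiZeroGp_phiGp (c : d.Φ.obj (op C)) :
    MonGp.map ((phiZeroOn d.base).map f.op).hom (d.phiGp C c) = d.phiGp B ((d.Φ.map f.op).hom c) := by
  have n := congrArg (fun φ => φ.hom c) (d.ι.naturality f.op)
  simp only [CommMonCat.hom_comp, MonoidHom.comp_apply] at n
  change MonGp.map _ (Algebra.GrothendieckGroup.of ((d.ι.app (op C)).hom c)) =
    Algebra.GrothendieckGroup.of ((d.ι.app (op B)).hom ((d.Φ.map f.op).hom c))
  rw [MonGp.map_of, n]

/-- `Div₀(x|_{K_B}) = Φ₀^gp(f)(Div₀ x)` for `x ∈ K_C^×` (naturality of `B₀ → Φ₀^gp`).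
[cite: MochizukiFrdII2008, Ex 1.1 (i) p.7] -/
theorem phiZeroGp_divZeroHom (x : (d.fld C)ˣ) :
    divZeroHom (d.fld B) (Units.map ((d.base.map f).alg : d.fld C →* d.fld B) x) =
      MonGp.map ((phiZeroOn d.base).map f.op).hom (divZeroHom (d.fld C) x) := by
  have n := congrArg (fun φ => φ.hom x) ((divZeroOn d.base).naturality f.op)
  simp only [CommMonCat.hom_comp, MonoidHom.comp_apply] at n
  exact n

/-- `Div_B(B(f) c) = Φ^gp(f)(Div_B c)` (naturality of `Div_B`). [cite: MochizukiFrdII2008, Ex 1.1 (ii) p.8] -/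
theorem divB_mapB (c : d.B.obj (op C)) :
    Frobenioids.divB d.Φ d.B d.divB (op B) ((d.B.map f.op).hom c) =
      pullGp d.Φ f (Frobenioids.divB d.Φ d.B d.divB (op C) c) := by
  have n := congrArg (fun φ => φ.hom c) (d.divB.naturality f.op)
  simp only [CommMonCat.hom_comp, MonoidHom.comp_apply] at n
  exact n

/-- An endomorphism `σ` of `B` OVER `C` (`σ ≫ f = f`) fixes the image of `K_C` in `K_B` pointwise (functoriality of
the base functor `D → D₀`). [cite: MochizukiFrdII2008, Thm 2.4 (i) p.20] -/
theorem alg_baseMap_over (σ : B ⟶ B) (hσ : σ ≫ f = f) (t : d.fld C) :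
    (d.base.map σ).alg ((d.base.map f).alg t) = (d.base.map f).alg t := by
  have h : d.base.map σ ≫ d.base.map f = d.base.map f := by rw [← Functor.map_comp, hσ]
  have h' := congrArg (fun φ : d.base.obj B ⟶ d.base.obj C => φ.alg t) h
  simpa only [PadicFld.comp_alg, RingHom.comp_apply] using h'

/-- An endomorphism `σ` of `B` acts trivially on `Φ^gp(B)` (`End_D(B)` acts trivially on `Φ(B)`,
abc-iut-L1-d10's `Datum.endTrivial`). [cite: MochizukiFrdII2008, Thm 1.2 (i) p.9] -/
theorem pullGp_endo (σ : B ⟶ B) (γ : Algebra.GrothendieckGroup (d.Φ.obj (op B))) : pullGp d.Φ σ γ = γ := by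
  change MonGp.map (d.Φ.map σ.op).hom γ = γ
  rw [d.endTrivial σ]
  obtain ⟨a, b, hab⟩ := grothendieckGroup_exists_mul_of_eq_of γ
  have h : γ = Algebra.GrothendieckGroup.of a / Algebra.GrothendieckGroup.of b := eq_div_iff_mul_eq'.mpr hab
  rw [h, map_div, MonGp.map_of, MonGp.map_of]
  rfl

end Naturality

end Datum

end PadicFrd

end Literature.AlgebraicGeometry.Frobenioids

end
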